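import Mathlib
import HarnessLib
import Summits.Ventures.LatticeQCDFlow.Exactness.TransformedKernel
import Summits.Ventures.LatticeQCDFlow.Exactness.InvolutiveMetropolis

/-!
# THMC end to end: the HMC kernel for Lüscher's modified Hamiltonian, reported through the map, is exact

HONEST FRAMING: exact (Metropolis-corrected) sampling algorithms for lattice gauge theory;
figures of merit are autocorrelation/cost numbers at stated couplings and volumes; no
continuum-physics claim.

Venture `LatticeQCDFlow` (cell pub-lqcd), topic `Exactness`; FANOUT row 7 (`s0-cpn-null`, S0-D1:
the leading-order trivializing map inside HMC vs HMC, Engel–Schaefer 2011).  NEW WORK of the cell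
over Mathlib and the tree's `Exactness/FlowPushforward.lean` (`HasJacobian`),
`Exactness/TransformedKernel.lean` (`conjKernel`, `thmc_exact`, `correlation_conjKernel_nHit`) and
`Exactness/InvolutiveMetropolis.lean` (`involMH_invariant`: the HMC skeleton — a
volume-preserving involution of phase space proposed deterministically and Metropolis-tested on
`e^{−H}` is exact); nothing here is cited as a fact.  Printed counterparts, named only: Lüscher
2010 §2.3–§2.4 eqs. (2.9)–(2.13) (the HMC algorithm for `H̃(π, V) = ½(π, π) + S(𝓕(V)) −
ln det 𝓕_*(V)`; "the momenta are not transformed"), Engel–Schaefer 2011 §2, Duane et al. 1987.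

## Content

* `HasJacobian.prodMap` — Jacobians of product maps multiply: if `F` has Jacobian `J` w.r.t. `vol`
  and `G` has Jacobian `K` w.r.t. `volP` (s-finite), `F × G` has Jacobian `J ⊗ K` w.r.t.
  `vol ⊗ volP`; `HasJacobian.prodMap_id` — lifting the field transformation to PHASE SPACE with
  the momenta untouched, `(v, π) ↦ (F v, π)`, keeps the Jacobian `J(v)`: this is why the modified
  Hamiltonian is `H̃(v, π) = T(π) + S̃(v)` with the SAME kinetic term.
* **`thmc_hmc_exact`** — THE THEOREM OF THE RUNG'S ALGORITHM.  Phase space `Ω × P` with reference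
  measure `vol ⊗ volP`; target `e^{−(S(u) + T(π))} · vol ⊗ volP` (any measurable action `S` and
  kinetic term `T`); field transformation `F : Ω ≃ᵐ Ω` with positive Jacobian `J`; modified
  Hamiltonian `H̃(v, π) = (S(F v) − log J(v)) + T(π)`; `Φ` ANY measurable `vol ⊗ volP`-preserving
  involution of phase space (the molecular-dynamics integrator for `H̃` followed by the momentum
  flip — leapfrog, or the fourth-order integrators of the card, at any step size).  Then the HMC
  kernel `involMH Φ _ H̃` (propose `Φ`, accept with `min(1, e^{−ΔH̃})`) REPORTED through
  `F × id` leaves `e^{−(S + T)} · vol ⊗ volP` invariant.  Ingredients: `involMH_invariant` for `H̃`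
  on the `V`-phase space, `prodMap_id`, `thmc_exact`.  `thmc_hmc_isReversible`: it is even
  reversible.
* `correlation_conjKernel_nHit_of_invariant` — if an observable is INVARIANT under the map
  (`O ∘ F = O`; e.g. an exactly map-invariant charge), its lag-`n` stationary correlations under
  the reported chain are those of `O` itself under the `V`-chain: for such observables the map acts
  ONLY through the dynamics of the modified action — the precise sense in which "the map can at
  best change what HMC does for `S̃` versus `S`" (the rung's null concerns `Q`, which the smooth
  leading-order map leaves nearly, not exactly, invariant; nothing quantitative is claimed).

Not here: momentum refreshment and the configuration-space marginal (the tree's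
`Phi4HMCExact.hmc_exact_of_involutive` does this on `ℝ^Λ`; on a group manifold it needs the
Liouville measure of `T*G^E`), the construction of `Φ` for a concrete integrator on a manifold,
ergodicity.
-/

namespace Summit.Ventures.LatticeQCDFlow.Exactness

open MeasureTheory ProbabilityTheory ProbabilityTheory.Kernel
open scoped ENNReal

variable {Ω P : Type*} [MeasurableSpace Ω] [MeasurableSpace P]

/-! ## Jacobians of product maps -/

/-- **Jacobians of product maps multiply**: `F × G` has Jacobian `(v, π) ↦ J(v) K(π)` w.r.t.
`vol ⊗ volP` (s-finite measures). -/
theorem HasJacobian.prodMap {vol : Measure Ω} {volP : Measure P} [SFinite vol] [SFinite volP]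
    {F : Ω → Ω} {J : Ω → ℝ≥0∞} (hF : HasJacobian vol F J) {G : P → P} {K : P → ℝ≥0∞}
    (hG : HasJacobian volP G K) :
    HasJacobian (vol.prod volP) (Prod.map F G) fun z => J z.1 * K z.2 where
  measurable := hF.measurable.prodMap hG.measurable
  measurable_jac :=
    (hF.measurable_jac.comp measurable_fst).mul (hG.measurable_jac.comp measurable_snd)
  map_eq := by
    rw [← prod_withDensity hF.measurable_jac hG.measurable_jac,
      ← Measure.map_prod_map _ _ hF.measurable hG.measurable, hF.map_eq, hG.map_eq]

/-- **Momenta untouched**: lifting `F` to phase space as `(v, π) ↦ (F v, π)` keeps the Jacobian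
`J(v)` w.r.t. `vol ⊗ volP`. -/
theorem HasJacobian.prodMap_id {vol : Measure Ω} (volP : Measure P) [SFinite vol] [SFinite volP]
    {F : Ω → Ω} {J : Ω → ℝ≥0∞} (hF : HasJacobian vol F J) :
    HasJacobian (vol.prod volP) (Prod.map F id) fun z => J z.1 := by
  have h := hF.prodMap (hasJacobian_id volP)
  simp only [mul_one] at h
  exact h

/-- The phase-space lift of a measurable bijection `F` as a measurable bijection:
`F.prodCongr (refl P)` acts as `(v, π) ↦ (F v, π)`. -/
theorem coe_prodCongr_refl (F : Ω ≃ᵐ Ω) :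
    ⇑(F.prodCongr (MeasurableEquiv.refl P)) = Prod.map F id := rfl

/-! ## THMC end to end -/

section THMC

variable {vol : Measure Ω} {volP : Measure P} [SFinite vol] [SFinite volP] {F : Ω ≃ᵐ Ω} {J : Ω → ℝ}
  {S : Ω → ℝ} {T : P → ℝ} {Φ : Ω × P → Ω × P} {hΦ : Measurable Φ}

/-- The modified Hamiltonian `H̃(v, π) = (S(F v) − log J(v)) + T(π)` is measurable. -/
theorem measurable_modifiedHamiltonian (hS : Measurable S) (hT : Measurable T)
    (hJm : Measurable J) (F : Ω ≃ᵐ Ω) :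
    Measurable fun z : Ω × P => (S (F z.1) - Real.log (J z.1)) + T z.2 :=
  (((hS.comp F.measurable).sub (Real.measurable_log.comp hJm)).comp measurable_fst).add
    (hT.comp measurable_snd)

/-- **THMC is exact (end to end).**  With target `e^{−(S(u) + T(π))} · vol ⊗ volP` on phase space,
a field transformation `F` with positive measurable Jacobian `J` (`F_*(J · vol) = vol`), the
modified Hamiltonian `H̃(v, π) = (S(F v) − log J(v)) + T(π)`, and ANY measurable
`vol ⊗ volP`-preserving involution `Φ` of phase space (integrator ∘ momentum flip for `H̃`): the
HMC kernel `involMH Φ _ H̃` — propose `Φ(v, π)`, accept with probability `min(1, e^{−ΔH̃})` —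
reported in the variables `(u, π) = (F v, π)` leaves `e^{−(S + T)} · vol ⊗ volP` invariant.  The
integrator's accuracy and the quality of the map affect the acceptance and the autocorrelations,
never the sampled law. -/
theorem thmc_hmc_exact (hJ : ∀ v, 0 < J v) (hJm : Measurable J)
    (hF : HasJacobian vol F fun v => ENNReal.ofReal (J v)) (hS : Measurable S) (hT : Measurable T)
    (hinv : Function.Involutive Φ) (hvol : MeasurePreserving Φ (vol.prod volP) (vol.prod volP)) :
    Invariant
      (conjKernel (involMH Φ hΦ fun z : Ω × P => (S (F z.1) - Real.log (J z.1)) + T z.2)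
        (F.prodCongr (MeasurableEquiv.refl P)))
      ((vol.prod volP).withDensity fun z => ENNReal.ofReal (Real.exp (-(S z.1 + T z.2)))) := by
  -- the HMC kernel for `H̃` is exact for `e^{−H̃}` on the `V`-phase space
  have hHMC := involMH_invariant (vol := vol.prod volP) (hΦ := hΦ)
    (measurable_modifiedHamiltonian hS hT hJm F) hinv hvol
  -- the lifted map has Jacobian `J(v)`
  have hF' : HasJacobian (vol.prod volP) (F.prodCongr (MeasurableEquiv.refl P))
      fun z => ENNReal.ofReal (J z.1) := by
    rw [coe_prodCongr_refl]
    exact hF.prodMap_id volP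
  -- `thmc_exact` on phase space with "action" `S(u) + T(π)`
  have h := thmc_exact (Ω := Ω × P) (F := F.prodCongr (MeasurableEquiv.refl P))
    (J := fun z => J z.1) (S := fun z => S z.1 + T z.2) (fun z => hJ z.1) hF'
    ((hS.comp measurable_fst).add (hT.comp measurable_snd))
    (κ := involMH Φ hΦ fun z : Ω × P => (S (F z.1) - Real.log (J z.1)) + T z.2) ?_
  · exact h
  · convert hHMC using 3
    simp only [coe_prodCongr_refl, Prod.map_fst, Prod.map_snd, id_eq]
    ring_nf

/-- THMC is reversible (detailed balance with respect to `e^{−(S + T)} · vol ⊗ volP`), under the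
same hypotheses. -/
theorem thmc_hmc_isReversible (hJ : ∀ v, 0 < J v) (hJm : Measurable J)
    (hF : HasJacobian vol F fun v => ENNReal.ofReal (J v)) (hS : Measurable S) (hT : Measurable T)
    (hinv : Function.Involutive Φ) (hvol : MeasurePreserving Φ (vol.prod volP) (vol.prod volP)) :
    IsReversible
      (conjKernel (involMH Φ hΦ fun z : Ω × P => (S (F z.1) - Real.log (J z.1)) + T z.2)
        (F.prodCongr (MeasurableEquiv.refl P)))
      ((vol.prod volP).withDensity fun z => ENNReal.ofReal (Real.exp (-(S z.1 + T z.2)))) := by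
  have hHMC := involMH_isReversible (vol := vol.prod volP) (hΦ := hΦ)
    (measurable_modifiedHamiltonian hS hT hJm F) hinv hvol
  have hF' : HasJacobian (vol.prod volP) (F.prodCongr (MeasurableEquiv.refl P))
      fun z => ENNReal.ofReal (J z.1) := by
    rw [coe_prodCongr_refl]
    exact hF.prodMap_id volP
  have h := thmc_isReversible (Ω := Ω × P) (F := F.prodCongr (MeasurableEquiv.refl P))
    (J := fun z => J z.1) (S := fun z => S z.1 + T z.2) (fun z => hJ z.1) hF'
    ((hS.comp measurable_fst).add (hT.comp measurable_snd))
    (κ := involMH Φ hΦ fun z : Ω × P => (S (F z.1) - Real.log (J z.1)) + T z.2) ?_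
  · exact h
  · convert hHMC using 3
    simp only [coe_prodCongr_refl, Prod.map_fst, Prod.map_snd, id_eq]
    ring_nf

end THMC

/-! ## Map-invariant observables -/

/-- **Map-invariant observables see only the modified dynamics.**  If `O ∘ F = O`, the lag-`n`
stationary correlation of `O` under the reported chain (from `F_*ν`) equals that of `O` itself
under the `V`-chain (from `ν`): for such observables the field transformation acts only through
the dynamics of the modified action. -/
theorem correlation_conjKernel_nHit_of_invariant {Ω' : Type*} [MeasurableSpace Ω']
    (κ : Kernel Ω Ω) (F : Ω ≃ᵐ Ω') (ν : Measure Ω) {O : Ω' → ℝ} {O₀ : Ω → ℝ}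
    (hO : ∀ v, O (F v) = O₀ v) (n : ℕ) :
    ∫ x, O x * (∫ y, O y ∂(nHit (conjKernel κ F) n x)) ∂(ν.map F) =
      ∫ v, O₀ v * (∫ w, O₀ w ∂(nHit κ n v)) ∂ν := by
  rw [correlation_conjKernel_nHit]
  simp only [hO]

end Summit.Ventures.LatticeQCDFlow.Exactness
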